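import Literature.AlgebraicGeometry.HodgeTheory.HardLefschetzPureDimensional
import Literature.AlgebraicGeometry.Motives.VarietiesProperProofs
import Mathlib.AlgebraicGeometry.Limits
import HarnessLib

/-!
# A pure-dimensional smooth projective complex scheme is the COPRODUCT of its (finitely many) components

Family `hodge`, layer `Literature/AlgebraicGeometry/HodgeTheory`.  PROOF FILE (theorems only; no definition,
no named fact).  Refinement of the tree's `HodgeTheory.exists_components_isSmoothProjective`
(`HardLefschetzPureDimensional`): for `X` smooth of relative dimension `d` over `ℂ` and projective, the
irreducible components `E_Z ↪ X` (open AND closed subschemes, smooth projective geometrically irreducible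
`d`-folds, complex points a clopen partition of `X(ℂ)`) are FINITE in number (a Noetherian scheme has finitely
many irreducible components, Stacks 0BA8 / Mathlib `NoetherianSpace.finite_irreducibleComponents`) and
exhibit `X` as their coproduct IN `SchemeOver ℂ`: the cofan `(E_Z ⟶ X)_Z` is a colimit (pairwise disjoint
covering open subschemes; Mathlib `AlgebraicGeometry.nonempty_isColimit_cofanMk_of`, lifted along
`Over.forget`, which creates colimits).

* `exists_components_isSmoothProjective_isColimit` — the statement.

Use (cells pub-hodgecm / pub-hodgecm2, S2 pinning, TEAM hComp (U3)): the consumer's interface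
«`X` smooth of rel. dim `n`, projective ⇒ finitely many open-closed `X_c`, each `IsSmoothProjective n X_c`,
cofan colimit, `X_c(ℂ)` = the connected components of `X(ℂ)`» (pin-1's `HCOMP-ANATOMY.md` §4), for
`X = X_K ⊗_{E,ι₁} ℂ` a Shimura surface, which is not geometrically connected.

## References
* [GortzWedhorn2020] U. Görtz, T. Wedhorn, *Algebraic Geometry I* (2nd ed. 2020), Exercise 3.16 (the local rings of
  a smooth scheme are domains; components are open and disjoint), Prop. 3.35 / §(5.2).
* [StacksProject] Tag 0BA8 (Noetherian topological spaces have finitely many irreducible components).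
-/

set_option autoImplicit false

noncomputable section

open CategoryTheory CategoryTheory.Limits AlgebraicGeometry Set Function
open Literature.AlgebraicTopology.SingularHomology

namespace Literature.AlgebraicGeometry.HodgeTheory

open _root_.Topology
open Literature.AlgebraicGeometry.Motives

universe v

variable {X : SchemeOver ℂ} {d : ℕ}

/-- **A pure-dimensional smooth projective complex scheme is the finite coproduct of its components.**
Let `X` be smooth of relative dimension `d` over `ℂ` and projective.  Then there are FINITELY many
`ℂ`-schemes `E_c` with morphisms `e_c : E_c ⟶ X` over `ℂ` that are open and closed immersions, each `E_c` a
smooth projective geometrically irreducible `d`-fold, whose images on complex points form a clopen partition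
of `X(ℂ)`, and the cofan `(e_c)_c` is a COLIMIT in `SchemeOver ℂ` (`X ≅ ∐_c E_c`): the `E_c` are the open
subschemes on the irreducible components (open because the local rings of the smooth `X` are domains,
Görtz–Wedhorn I Ex. 3.16; pairwise disjoint; covering; finitely many since `X` is Noetherian), and pairwise
disjoint covering open subschemes form a coproduct (Mathlib `nonempty_isColimit_cofanMk_of`; `Over.forget`
creates colimits).  The first four clauses are the tree's `exists_components_isSmoothProjective`, re-derived
here on the same construction so that finiteness and the colimit can be read off.
[cite: GortzWedhorn2020, Exercise 3.16 (p. 117)] [cite: StacksProject, Tag 0BA8] -/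
theorem exists_components_isSmoothProjective_isColimit [SmoothOfRelativeDimension d X.hom]
    (hX : IsProjectiveOver X) :
    ∃ (C : Type) (_ : Finite C) (E : C → SchemeOver ℂ) (e : ∀ c, E c ⟶ X),
      (∀ c, IsSmoothProjective d (E c)) ∧ (∀ c, IsOpenImmersion (e c).left) ∧
        (∀ c, IsClosedImmersion (e c).left) ∧
        IsClopenPartition (fun c => Set.range (AlgPoints.map (L := ℂ) (e c))) ∧
        Nonempty (IsColimit (Cofan.mk X e)) := by
  classical
  haveI : IsProper X.hom := hX.isProper
  haveI : IsLocallyNoetherian X.left := LocallyOfFiniteType.isLocallyNoetherian X.hom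
  haveI : CompactSpace X.left := (quasiCompact_iff_compactSpace X.hom).mp inferInstance
  haveI : IsNoetherian X.left := { }
  have hdom : ∀ x : X.left, IsDomain (X.left.presheaf.stalk x) := fun x ↦
    isDomain_stalk_of_smoothOfRelativeDimension X.hom d x
  haveI : IsReduced X.left := isReduced_of_smoothOfRelativeDimension X.hom d
  -- the components, as open subschemes; finitely many
  set C := irreducibleComponents X.left with hC
  haveI hfin : Finite C := (TopologicalSpace.NoetherianSpace.finite_irreducibleComponents (α := X.left)).to_subtype
  have hopen : ∀ Z : C, IsOpen (Z.1 : Set X.left) := fun Z ↦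
    isOpen_of_mem_irreducibleComponents_of_isDomain_stalk hdom Z.2
  let U : C → X.left.Opens := fun Z ↦ ⟨Z.1, hopen Z⟩
  let EZ : C → SchemeOver ℂ := fun Z ↦ Over.mk ((U Z).ι ≫ X.hom)
  let eZ : ∀ Z : C, EZ Z ⟶ X := fun Z ↦ Over.homMk (U Z).ι rfl
  haveI heZopen : ∀ Z : C, IsOpenImmersion (eZ Z).left := fun Z ↦
    inferInstanceAs (IsOpenImmersion (U Z).ι)
  have hrangeZ : ∀ Z : C, Set.range (U Z).ι = (Z.1 : Set X.left) := fun Z ↦ Scheme.Opens.range_ι _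
  have hopensRange : ∀ Z : C, (eZ Z).left.opensRange = U Z := fun Z ↦ Scheme.Opens.opensRange_ι _
  haveI heZclosed : ∀ Z : C, IsClosedImmersion (eZ Z).left := fun Z ↦ by
    refine IsClosedImmersion.of_isPreimmersion _ ?_
    change IsClosed (Set.range (U Z).ι)
    rw [hrangeZ]
    exact isClosed_of_mem_irreducibleComponents _ Z.2
  -- each component is a smooth projective (geometrically irreducible) variety of dimension `d`
  have hEZ : ∀ Z : C, IsSmoothProjective d (EZ Z) := by
    intro Z
    have hsm : SmoothOfRelativeDimension d (EZ Z).hom :=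
      IsZariskiLocalAtSource.comp (P := @SmoothOfRelativeDimension d) ‹_› (U Z).ι
    have hproj : IsProjectiveOver (EZ Z) :=
      Resolution.isProjectiveOver_of_isClosedImmersion_left (eZ Z) hX
    haveI : IrreducibleSpace (EZ Z).left := by
      change IrreducibleSpace (U Z)
      have hirr : IsIrreducible ((U Z : X.left.Opens) : Set X.left) := Z.2.1
      exact Subtype.irreducibleSpace hirr
    haveI : IsReduced (EZ Z).left := isReduced_of_smoothOfRelativeDimension (EZ Z).hom d
    haveI : IsIntegral (EZ Z).left := isIntegral_of_irreducibleSpace_of_isReduced _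
    haveI := geometricallyIntegral_of_isAlgClosed (EZ Z).hom
    exact ⟨hsm, hproj, inferInstance⟩
  -- the complex points of the components form a clopen partition of `X(ℂ)`
  let A : C → Set (ComplexPoints X) := fun Z ↦ Set.range (AlgPoints.map (L := ℂ) (eZ Z))
  have hArange : ∀ Z : C, A Z = {P : ComplexPoints X | P.pt ∈ (Z.1 : Set X.left)} := by
    intro Z
    change Set.range (AlgPoints.map (L := ℂ) (eZ Z)) = _
    rw [AlgPoints.range_map_of_isOpenImmersion_holds (L := ℂ) (eZ Z)]
    ext P
    change P.pt ∈ (((U Z).ι.opensRange : X.left.Opens) : Set X.left) ↔ P.pt ∈ (Z.1 : Set X.left)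
    rw [Scheme.Opens.opensRange_ι]
    rfl
  have hdisjZ : ∀ Z₁ Z₂ : C, Z₁ ≠ Z₂ → Disjoint (Z₁.1 : Set X.left) Z₂.1 := fun Z₁ Z₂ hne ↦
    disjoint_of_mem_irreducibleComponents_of_isOpen Z₁.2 Z₂.2 (hopen Z₂) (fun h ↦ hne (Subtype.ext h))
  have hA : IsClopenPartition A := by
    refine IsClopenPartition.of_pairwise_disjoint (fun Z ↦ ?_) (fun Z₁ Z₂ hne ↦ ?_) ?_
    · exact (AlgPoints.isOpenEmbedding_map_holds (L := ℂ) (eZ Z)).isOpen_range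
    · change Disjoint (A Z₁) (A Z₂)
      rw [hArange, hArange, Set.disjoint_left]
      intro P h₁ h₂
      exact Set.disjoint_left.mp (hdisjZ Z₁ Z₂ hne) h₁ h₂
    · refine Set.eq_univ_of_forall fun P ↦ Set.mem_iUnion.mpr ?_
      refine ⟨⟨irreducibleComponent P.pt, irreducibleComponent_mem_irreducibleComponents _⟩, ?_⟩
      rw [hArange]
      exact mem_irreducibleComponent
  -- the cofan of the components is a colimit of schemes …
  have hcov : ⨆ Z : C, (eZ Z).left.opensRange = ⊤ := by
    rw [eq_top_iff]
    rintro x -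
    refine TopologicalSpace.Opens.mem_iSup.mpr
      ⟨⟨irreducibleComponent x, irreducibleComponent_mem_irreducibleComponents _⟩, ?_⟩
    rw [hopensRange]
    exact mem_irreducibleComponent
  have hdisj : Pairwise (Disjoint on fun Z : C => (eZ Z).left.opensRange) := by
    intro Z₁ Z₂ hne
    change Disjoint (eZ Z₁).left.opensRange (eZ Z₂).left.opensRange
    rw [hopensRange, hopensRange, ← TopologicalSpace.Opens.coe_disjoint]
    exact hdisjZ Z₁ Z₂ hne
  obtain ⟨hS⟩ := nonempty_isColimit_cofanMk_of (fun Z : C => (eZ Z).left) hcov hdisj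
  -- … hence in `SchemeOver ℂ` (`Over.forget` creates colimits)
  have hOver : Nonempty (IsColimit (Cofan.mk X eZ)) := by
    have h2 : IsColimit ((Over.forget (Spec (CommRingCat.of ℂ))).mapCocone (Cofan.mk X eZ)) :=
      (Cofan.isColimitMapCoconeEquiv (Over.forget (Spec (CommRingCat.of ℂ))) EZ (Cofan.mk X eZ)).symm hS
    exact ⟨isColimitOfReflects (Over.forget _) h2⟩
  exact ⟨C, hfin, EZ, eZ, hEZ, heZopen, heZclosed, hA, hOver⟩

end Literature.AlgebraicGeometry.HodgeTheory

end
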